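import Literature.Computability.QuantumComplexity.OneQubitEuler
import HarnessLib

/-!
# Boykin et al. 1999, §3: the words `R₁ = σ_z^{-1/4}σ_x^{1/4}` and `G`, and the orthogonality of the axes

Topic `Literature/Computability/QuantumComplexity`, grouping namespace `BoykinEtAl` (the paper).
The explicit one-qubit computations behind the first step of the universality proof of
Boykin–Mor–Pulver–Roychowdhury–Vatan (FOCS 1999, §3), all exact in `ℚ(ω)`, `ω = e^{iπ/4}`,
`ω⁴ = -1`:

* `R₁U = T⁷ (H T H)` — the word `σ_z^{-1/4} σ_x^{1/4}` (eq. (en1); `T = σ_z^{1/4}`,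
  `H T H = σ_x^{1/4}`, `T⁻¹ = T⁷`) and its matrix `R₁m = ½[[1+ω, 1-ω], [-(1+ω³), 1-ω³]]`;
* `GU = T² (HTH) T⁶ (HT⁷H) T⁶` — a word equal to `(H^{1/2})⁻¹` for the paper's
  `H^{1/2} = σ_y^{1/4} σ_z^{1/2} σ_y^{-1/4}` (eq. (en2)), with matrix `Gm` and adjoint;
* `cR = cos λπ = cos²(π/8) = (2+√2)/4`, `sR = sin λπ` (eq. (lambda)), `coe_cR : c = ½ + (ω-ω³)/4`;
* `A₁m = R₁ - c·1` (`= i sin λπ · n̂₁·σ⃗`), `A₂m = G A₁ G†` (`= i sin λπ · n̂₂·σ⃗`) and the three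
  identities the assembly needs: `A₁† = -A₁`, `A₁² = -(1-c²)·1`, and **`A₁A₂ = -A₂A₁`** — the
  orthogonality `n̂₁ ⊥ n̂₂` of eq. (axes).

Every entry identity is a polynomial identity in `ω` modulo `ω⁴ = -1`, certified by
`linear_combination q(ω) * hω` with an explicit quotient `q`.

## References

* P. O. Boykin, T. Mor, M. Pulver, V. Roychowdhury, F. Vatan, *On universal and fault-tolerant
  quantum computing*, FOCS 1999, 486–494, arXiv:quant-ph/9906054, §2 (`σ_x^α = Hσ_z^αH`,
  `σ_y^α`, `H^α`) and §3, eqs. (en1), (en2), (lambda), (axes) [BoykinEtAl1999].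

## Design notes

* We do not formalise "`G = H^{-1/2}`" (irrelevant): only `G ∈ ⟨H, T⟩` and its matrix are used.
* The paper normalises `R₁ = e^{iλπ n̂₁·σ⃗}` in `SU(2)`; here `det R₁ = 1` holds on the nose
  (`det T⁷ · det(HTH) = ω⁷ · ω = 1`), so no phase correction is needed.
-/

noncomputable section

namespace Literature.Computability.QuantumComplexity.BoykinEtAl

open Cryptography Matrix Complex OneQubit

/-! ### The eighth root of unity `ω` -/

/-- `ω = e^{iπ/4} = (√2/2)(1 + i)`. (Cf. `omega_eq` of `ControlledHadamard.lean`, heavy imports;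
repeated here.) [folklore] -/
theorem omega_eq_sqrt_two : omega = ((Real.sqrt 2 / 2 : ℝ) : ℂ) * (1 + I) := by
  have h : omega = Complex.exp (((Real.pi / 4 : ℝ) : ℂ) * I) := by
    simp only [omega]; push_cast; ring_nf
  rw [h, Complex.exp_mul_I, ← Complex.ofReal_cos, ← Complex.ofReal_sin, Real.cos_pi_div_four,
    Real.sin_pi_div_four]
  ring

/-- `‖ω‖ = 1`. [folklore] -/
theorem norm_omega : ‖omega‖ = 1 := by
  have h : omega = Complex.exp (((Real.pi / 4 : ℝ) : ℂ) * I) := by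
    simp only [omega]; push_cast; ring_nf
  rw [h]
  exact Complex.norm_exp_ofReal_mul_I _

/-- `√2 = ω - ω³` (`= ω + ω̄ = 2cos(π/4)`). [folklore] -/
theorem sqrt_two_eq_omega : ((Real.sqrt 2 : ℝ) : ℂ) = omega - omega ^ 3 := by
  have h3 : omega ^ 3 = omega * I := by rw [pow_succ, omega_pow_two, mul_comm]
  have hs : ((Real.sqrt 2 / 2 : ℝ) : ℂ) * 2 = ((Real.sqrt 2 : ℝ) : ℂ) := by push_cast; ring
  rw [h3, omega_eq_sqrt_two, ← hs]
  have hI : I * I = -1 := Complex.I_mul_I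
  linear_combination ((Real.sqrt 2 / 2 : ℝ) : ℂ) * hI

/-- `ω̄ = ω⁻¹ = ω⁷ = -ω³`. (Same statement as `conj_omega` of `ZWRing.lean`, which imports the
Forrelation/`ControlledHadamard` chain; the short proof is repeated to keep this file's imports
light.) [folklore] -/
theorem conj_omega : starRingEnd ℂ omega = -omega ^ 3 := by
  have hinv : starRingEnd ℂ omega = omega⁻¹ := by
    rw [Complex.inv_def, Complex.normSq_eq_norm_sq, norm_omega]; simp
  have h7 : omega * (-omega ^ 3) = 1 := by
    have h4 := omega_pow_four
    linear_combination (-1 : ℂ) * h4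
  rw [hinv]
  exact inv_eq_of_mul_eq_one_right h7

/-! ### Powers of `T` and conjugation by `H` -/

/-- `Tᵏ = diag(1, ωᵏ)`. [folklore] -/
theorem tGate_pow (k : ℕ) : tGate ^ k = m2 1 0 0 (omega ^ k) := by
  induction k with
  | zero => rw [pow_zero, pow_zero, one_eq_m2]
  | succ k ih =>
    rw [pow_succ, ih, tGate_eq_m2, m2_mul_m2, m2_inj]
    refine ⟨by ring, by ring, by ring, by ring⟩

/-- `H diag(1, x) H = ½[[1+x, 1-x], [1-x, 1+x]]` (so `H T H = σ_x^{1/4}`, Boykin et al. §2: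
`σ_x^α = H σ_z^α H`). [cite: BoykinEtAl1999, §2] -/
theorem hGate_mul_diag_mul_hGate (x : ℂ) :
    hGate * m2 1 0 0 x * hGate = m2 ((1 + x) / 2) ((1 - x) / 2) ((1 - x) / 2) ((1 + x) / 2) := by
  rw [hGate_eq_m2, m2_mul_m2, m2_mul_m2, m2_inj]
  have h2 : invSqrt2 * invSqrt2 = 1 / 2 := invSqrt2_mul_invSqrt2
  refine ⟨?_, ?_, ?_, ?_⟩
  · linear_combination (1 + x) * h2
  · linear_combination (1 - x) * h2
  · linear_combination (1 - x) * h2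
  · linear_combination (1 + x) * h2

/-- `T` as an element of `U(2)`. [folklore] -/
def tU : Matrix.unitaryGroup (QReg 1) ℂ := ⟨tGate, tGate_mem_unitaryGroup_holds⟩

/-- Matrix of `tU`. [folklore] -/
@[simp] theorem coe_tU : ((tU : Matrix.unitaryGroup (QReg 1) ℂ) : Matrix (QReg 1) (QReg 1) ℂ) = tGate := rfl

/-! ### The first irrational rotation `R₁ = σ_z^{-1/4} σ_x^{1/4} = T⁷ (H T H)` -/

/-- `R₁ = σ_z^{-1/4} σ_x^{1/4}` as the word `T⁷ · (H T H)` in `U(2)` (`T⁻¹ = T⁷`; Boykin et al.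
1999, §3 eq. (en1)). [cite: BoykinEtAl1999, §3 eq. (en1)] -/
def R₁U : Matrix.unitaryGroup (QReg 1) ℂ := tU ^ 7 * (hU * tU * hU)

/-- The matrix of `R₁`: `½[[1+ω, 1-ω], [-(1+ω³), 1-ω³]]` (an element of `SU(2)` with
`Re` of the diagonal `= (2+√2)/4 = cos²(π/8) = cos λπ`, Boykin et al. eq. (lambda)). [cite: BoykinEtAl1999, §3 eq. (lambda)] -/
def R₁m : Matrix (QReg 1) (QReg 1) ℂ :=
  m2 ((1 + omega) / 2) ((1 - omega) / 2) (-(1 + omega ^ 3) / 2) ((1 - omega ^ 3) / 2)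

/-- `R₁U` has matrix `R₁m`. [cite: BoykinEtAl1999, §3 eq. (en1)] -/
theorem coe_R₁U : ((R₁U : Matrix.unitaryGroup (QReg 1) ℂ) : Matrix (QReg 1) (QReg 1) ℂ) = R₁m := by
  have hω := omega_pow_four
  change tGate ^ 7 * (hGate * tGate * hGate) = R₁m
  rw [tGate_pow, tGate_eq_m2, ← show omega ^ 1 = omega from pow_one omega, ← tGate_pow 1,
    tGate_pow 1, pow_one, hGate_mul_diag_mul_hGate, m2_mul_m2, R₁m, m2_inj]
  refine ⟨?_, ?_, ?_, ?_⟩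
  · linear_combination (0 : ℂ) * hω
  · linear_combination (0 : ℂ) * hω
  · linear_combination (((1 : ℂ) / 2) + ((1 : ℂ) / 2) * omega ^ 3 + ((-1 : ℂ) / 2) * omega ^ 4) * hω
  · linear_combination (((-1 : ℂ) / 2) + ((1 : ℂ) / 2) * omega ^ 3 + ((1 : ℂ) / 2) * omega ^ 4) * hω

/-! ### The conjugating word `G = H^{-1/2}` -/

/-- The word `G = T² (H T H) T⁶ (H T⁷ H) T⁶ = S σ_x^{1/4} S⁻¹ · σ_x^{-1/4} · S⁻¹`, which is
`(H^{1/2})⁻¹` for the paper's `H^{1/2} = σ_y^{1/4} σ_z^{1/2} σ_y^{-1/4}`,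
`σ_y^{1/4} = S σ_x^{1/4} S⁻¹` (Boykin et al. 1999, §2 identities and §3 eq. (en2)); only
`G ∈ ⟨H, T⟩` and its matrix matter below. [cite: BoykinEtAl1999, §3 eq. (en2)] -/
def GU : Matrix.unitaryGroup (QReg 1) ℂ :=
  tU ^ 2 * (hU * tU * hU) * tU ^ 6 * (hU * tU ^ 7 * hU) * tU ^ 6

/-- The matrix of `G`: `½[[1+ω-ω², ω], [ω, 1-ω-ω²]]`. [cite: BoykinEtAl1999, §3 eq. (en2)] -/
def Gm : Matrix (QReg 1) (QReg 1) ℂ :=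
  m2 (((1 : ℂ) / 2) + ((1 : ℂ) / 2) * omega + ((-1 : ℂ) / 2) * omega ^ 2) (((1 : ℂ) / 2) * omega) (((1 : ℂ) / 2) * omega) (((1 : ℂ) / 2) + ((-1 : ℂ) / 2) * omega + ((-1 : ℂ) / 2) * omega ^ 2)

/-- `GU` has matrix `Gm`. [cite: BoykinEtAl1999, §3 eq. (en2)] -/
theorem coe_GU : ((GU : Matrix.unitaryGroup (QReg 1) ℂ) : Matrix (QReg 1) (QReg 1) ℂ) = Gm := by
  have hω := omega_pow_four
  have hHTH : hGate * tGate * hGate =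
      m2 ((1 + omega) / 2) ((1 - omega) / 2) ((1 - omega) / 2) ((1 + omega) / 2) := by
    rw [← hGate_mul_diag_mul_hGate omega, ← pow_one omega, ← tGate_pow, pow_one]
  have hHT7H : hGate * tGate ^ 7 * hGate =
      m2 ((1 - omega ^ 3) / 2) ((1 + omega ^ 3) / 2) ((1 + omega ^ 3) / 2) ((1 - omega ^ 3) / 2) := by
    rw [tGate_pow, hGate_mul_diag_mul_hGate, m2_inj]
    refine ⟨?_, ?_, ?_, ?_⟩
    · linear_combination (((1 : ℂ) / 2) * omega ^ 3) * hω
    · linear_combination (((-1 : ℂ) / 2) * omega ^ 3) * hω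
    · linear_combination (((-1 : ℂ) / 2) * omega ^ 3) * hω
    · linear_combination (((1 : ℂ) / 2) * omega ^ 3) * hω
  have hT6 : tGate ^ 6 = m2 1 0 0 (-omega ^ 2) := by
    rw [tGate_pow, m2_inj]
    refine ⟨?_, ?_, ?_, ?_⟩
    · linear_combination (0 : ℂ) * hω
    · linear_combination (0 : ℂ) * hω
    · linear_combination (0 : ℂ) * hω
    · linear_combination ((1 : ℂ) * omega ^ 2) * hω
  change tGate ^ 2 * (hGate * tGate * hGate) * tGate ^ 6 * (hGate * tGate ^ 7 * hGate) * tGate ^ 6 = Gm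
  rw [hHTH, hHT7H, hT6, tGate_pow, m2_mul_m2, m2_mul_m2, m2_mul_m2, m2_mul_m2, Gm, m2_inj]
  refine ⟨?_, ?_, ?_, ?_⟩
  · linear_combination (((-1 : ℂ) / 4) + ((-1 : ℂ) / 4) * omega + ((1 : ℂ) / 4) * omega ^ 2) * hω
  · linear_combination (((-1 : ℂ) / 2) * omega + ((-1 : ℂ) / 4) * omega ^ 2 + ((-1 : ℂ) / 4) * omega ^ 3 + ((1 : ℂ) / 4) * omega ^ 4) * hω
  · linear_combination (((-1 : ℂ) / 2) * omega + ((1 : ℂ) / 4) * omega ^ 2 + ((-1 : ℂ) / 4) * omega ^ 3 + ((-1 : ℂ) / 4) * omega ^ 4) * hω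
  · linear_combination (((-1 : ℂ) / 2) + ((1 : ℂ) / 2) * omega + ((1 : ℂ) / 2) * omega ^ 2 + ((1 : ℂ) / 4) * omega ^ 4 + ((-1 : ℂ) / 4) * omega ^ 5 + ((-1 : ℂ) / 4) * omega ^ 6) * hω

/-- The adjoint of `Gm`. [folklore] -/
theorem conjTranspose_Gm : Gmᴴ = m2 (((1 : ℂ) / 2) + ((1 : ℂ) / 2) * omega ^ 2 + ((-1 : ℂ) / 2) * omega ^ 3) (((-1 : ℂ) / 2) * omega ^ 3) (((-1 : ℂ) / 2) * omega ^ 3) (((1 : ℂ) / 2) + ((1 : ℂ) / 2) * omega ^ 2 + ((1 : ℂ) / 2) * omega ^ 3) := by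
  have hω := omega_pow_four
  rw [Gm, conjTranspose_m2]
  simp only [map_add, map_mul, map_div₀, map_pow, map_neg, map_one, map_ofNat, conj_omega]
  rw [m2_inj]
  refine ⟨?_, ?_, ?_, ?_⟩
  · linear_combination (((-1 : ℂ) / 2) * omega ^ 2) * hω
  · linear_combination (0 : ℂ) * hω
  · linear_combination (0 : ℂ) * hω
  · linear_combination (((-1 : ℂ) / 2) * omega ^ 2) * hω

/-- `Gm Gm† = 1` (it is the matrix of a unitary). [folklore] -/
theorem Gm_mul_conjTranspose_Gm : Gm * Gmᴴ = 1 := by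
  rw [← coe_GU, ← star_eq_conjTranspose]
  exact Matrix.mem_unitaryGroup_iff.1 GU.2

/-- `Gm† Gm = 1`. [folklore] -/
theorem conjTranspose_Gm_mul_Gm : Gmᴴ * Gm = 1 := by
  rw [← coe_GU, ← star_eq_conjTranspose]
  exact Matrix.mem_unitaryGroup_iff'.1 GU.2

/-! ### The constants `c = cos λπ = cos²(π/8)` and `s = sin λπ` -/

/-- `c = cos λπ = cos²(π/8) = ½(1 + 1/√2) = (2 + √2)/4` (Boykin et al. 1999, eq. (lambda)).
[cite: BoykinEtAl1999, §3 eq. (lambda)] -/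
def cR : ℝ := (2 + Real.sqrt 2) / 4

/-- `s = sin λπ = √(1 - c²) > 0`. [cite: BoykinEtAl1999, §3 eq. (lambda)] -/
def sR : ℝ := Real.sqrt (1 - cR ^ 2)

/-- `0 < c`. [folklore] -/
theorem cR_pos : 0 < cR := by unfold cR; positivity

/-- `c < 1` (`√2 < 2`). [folklore] -/
theorem cR_lt_one : cR < 1 := by
  unfold cR
  have h : Real.sqrt 2 < 2 := by
    nlinarith [Real.sq_sqrt (show (0 : ℝ) ≤ 2 by norm_num), Real.sqrt_nonneg 2]
  linarith

/-- `0 < 1 - c²`. [folklore] -/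
theorem one_sub_cR_sq_pos : 0 < 1 - cR ^ 2 := by
  have h1 := cR_pos
  have h2 := cR_lt_one
  nlinarith

/-- `0 < s`. [folklore] -/
theorem sR_pos : 0 < sR := Real.sqrt_pos.2 one_sub_cR_sq_pos

/-- `s² = 1 - c²`. [folklore] -/
theorem sR_sq : sR ^ 2 = 1 - cR ^ 2 := Real.sq_sqrt one_sub_cR_sq_pos.le

/-- `2c = 1 + √2/2` (`= 2cos²(π/8) = 1 + cos(π/4)`). [cite: BoykinEtAl1999, §3 eq. (lambda)] -/
theorem two_mul_cR : 2 * cR = 1 + Real.sqrt 2 / 2 := by unfold cR; ring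

/-- `c` in terms of `ω`: `c = ½ + (ω - ω³)/4`. [folklore] -/
theorem coe_cR : ((cR : ℝ) : ℂ) = 1 / 2 + (omega - omega ^ 3) / 4 := by
  unfold cR
  push_cast
  rw [sqrt_two_eq_omega]
  ring

/-! ### `A₁ = R₁ - c·1 = i sin λπ (n̂₁·σ⃗)` and `A₂ = G A₁ G†` -/

/-- `A₁ = R₁ - c • 1` (`= i sin(λπ) n̂₁·σ⃗` in the notation of Boykin et al. eq. (en1)).
[cite: BoykinEtAl1999, §3 eq. (en1)] -/
def A₁m : Matrix (QReg 1) (QReg 1) ℂ := R₁m - ((cR : ℝ) : ℂ) • 1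

/-- `A₁` by entries: `[[ (ω+ω³)/4, (1-ω)/2 ], [ -(1+ω³)/2, -(ω+ω³)/4 ]]`. [folklore] -/
theorem A₁m_eq : A₁m = m2 (((1 : ℂ) / 4) * omega + ((1 : ℂ) / 4) * omega ^ 3) (((1 : ℂ) / 2) + ((-1 : ℂ) / 2) * omega) (((-1 : ℂ) / 2) + ((-1 : ℂ) / 2) * omega ^ 3) (((-1 : ℂ) / 4) * omega + ((-1 : ℂ) / 4) * omega ^ 3) := by
  rw [A₁m, R₁m, coe_cR, smul_one_eq_m2, m2_sub_m2, m2_inj]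
  refine ⟨by ring, by ring, by ring, by ring⟩

/-- `A₁† = -A₁` (`A₁ = i s P₁` with `P₁` Hermitian). [folklore] -/
theorem conjTranspose_A₁m : A₁mᴴ = -A₁m := by
  have hω := omega_pow_four
  rw [A₁m_eq, conjTranspose_m2, neg_m2]
  simp only [map_add, map_mul, map_div₀, map_pow, map_neg, map_one, map_ofNat, conj_omega]
  rw [m2_inj]
  refine ⟨?_, ?_, ?_, ?_⟩
  · linear_combination (((1 : ℂ) / 4) * omega + ((-1 : ℂ) / 4) * omega ^ 5) * hω
  · linear_combination (((-1 : ℂ) / 2) * omega + ((1 : ℂ) / 2) * omega ^ 5) * hω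
  · linear_combination (0 : ℂ) * hω
  · linear_combination (((-1 : ℂ) / 4) * omega + ((1 : ℂ) / 4) * omega ^ 5) * hω

/-- `A₁² = -(1 - c²) • 1 = -s² • 1` (`A₁ = i s P₁` with `P₁² = 1`; this is `cos²λπ + sin²λπ = 1`
for `R₁ = cos λπ + i sin λπ (n̂₁·σ⃗)`). [cite: BoykinEtAl1999, §3 eq. (lambda)] -/
theorem A₁m_mul_A₁m : A₁m * A₁m = (-(1 - ((cR : ℝ) : ℂ) ^ 2)) • (1 : Matrix (QReg 1) (QReg 1) ℂ) := by
  have hω := omega_pow_four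
  rw [A₁m_eq, m2_mul_m2, coe_cR, smul_one_eq_m2, m2_inj]
  refine ⟨?_, ?_, ?_, ?_⟩
  · linear_combination (((1 : ℂ) / 2)) * hω
  · linear_combination (0 : ℂ) * hω
  · linear_combination (0 : ℂ) * hω
  · linear_combination (((1 : ℂ) / 2)) * hω

/-- `A₂ = G A₁ G†` by entries (`= i sin(λπ) n̂₂·σ⃗`, Boykin et al. eq. (en2)).
[cite: BoykinEtAl1999, §3 eq. (en2)] -/
def A₂m : Matrix (QReg 1) (QReg 1) ℂ :=
  m2 (((-1 : ℂ) / 4) * omega + ((1 : ℂ) / 4) * omega ^ 2 + ((-1 : ℂ) / 4) * omega ^ 3) (((1 : ℂ) / 2) + ((1 : ℂ) / 4) * omega + ((-1 : ℂ) / 4) * omega ^ 2 + ((1 : ℂ) / 4) * omega ^ 3) (((-1 : ℂ) / 2) + ((1 : ℂ) / 4) * omega + ((-1 : ℂ) / 4) * omega ^ 2 + ((1 : ℂ) / 4) * omega ^ 3) (((1 : ℂ) / 4) * omega + ((-1 : ℂ) / 4) * omega ^ 2 + ((1 : ℂ) / 4) * omega ^ 3)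

/-- `G A₁ G† = A₂`. [cite: BoykinEtAl1999, §3 eq. (en2)] -/
theorem Gm_mul_A₁m_mul_conjTranspose_Gm : Gm * A₁m * Gmᴴ = A₂m := by
  have hω := omega_pow_four
  rw [A₁m_eq, conjTranspose_Gm, Gm, m2_mul_m2, m2_mul_m2, A₂m, m2_inj]
  refine ⟨?_, ?_, ?_, ?_⟩
  · linear_combination (((3 : ℂ) / 16) * omega + ((-3 : ℂ) / 16) * omega ^ 2 + ((1 : ℂ) / 16) * omega ^ 3 + ((1 : ℂ) / 16) * omega ^ 4) * hω
  · linear_combination (((-3 : ℂ) / 8) + ((-1 : ℂ) / 4) * omega + ((1 : ℂ) / 16) * omega ^ 2 + ((1 : ℂ) / 16) * omega ^ 4) * hω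
  · linear_combination (((3 : ℂ) / 8) + ((-1 : ℂ) / 8) * omega + ((5 : ℂ) / 16) * omega ^ 2 + ((-1 : ℂ) / 8) * omega ^ 3 + ((-3 : ℂ) / 16) * omega ^ 4) * hω
  · linear_combination (((-3 : ℂ) / 16) * omega + ((3 : ℂ) / 16) * omega ^ 2 + ((-1 : ℂ) / 16) * omega ^ 3 + ((-1 : ℂ) / 16) * omega ^ 4) * hω

/-- **The two axes are orthogonal** (Boykin et al. 1999, §3, eq. (axes): "one can easily verify
that `n⃗₁`, `n⃗₂` are orthogonal"): `A₁A₂ = -A₂A₁`, i.e. `{n̂₁·σ⃗, n̂₂·σ⃗} = 0`. An identity in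
`ℚ(ω)`, `ω⁴ = -1`. [cite: BoykinEtAl1999, §3 eq. (axes)] -/
theorem A₁m_mul_A₂m : A₁m * A₂m = -(A₂m * A₁m) := by
  have hω := omega_pow_four
  rw [← add_eq_zero_iff_eq_neg, A₁m_eq, A₂m, m2_mul_m2, m2_mul_m2, m2_add_m2, zero_eq_m2, m2_inj]
  refine ⟨?_, ?_, ?_, ?_⟩
  · linear_combination (((-1 : ℂ) / 2) + ((1 : ℂ) / 4) * omega + ((-1 : ℂ) / 4) * omega ^ 2) * hω
  · linear_combination (0 : ℂ) * hω
  · linear_combination (0 : ℂ) * hω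
  · linear_combination (((-1 : ℂ) / 2) + ((1 : ℂ) / 4) * omega + ((-1 : ℂ) / 4) * omega ^ 2) * hω

end Literature.Computability.QuantumComplexity.BoykinEtAl

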